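import Summits.QuantumFields.YangMills.Theorems.BalabanUVNodesN08AlphaEq324RowClassSocket

/-!
# Route «BalabanUVNodes», Track-A DAG node N08 = [Balaban1985UV3] Thm 1 p. 257 ∕ Thm 2 p. 272 — THE CLASS SOCKET UNDER AN ALMOST-EVERYWHERE PRESENTATION, and the
# G3D-02 functional at the free letter: sequel of `…N08AlphaEq324RowClassSocket` (part 2 of 2)

Cell `pub-ymgap`, seat `pub-ymgap-dag-n08-w4` gen 5 (INTENT-2).  `bears_on: R4∕N08`; filed `--supports stmt-QuantumFields-27364` (K1⁹, helper).  THEOREMS ONLY (def-free,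
sorry-free, standard axioms); part 1 (`…RowClassSocket`, §1–§4) consumed BY NAME.

WHY.  Part 1's transport (§3–§4) asks for the presentation identities EXACTLY: `(Φ h U)⁻¹'((𝔖 k).box h) = smallFieldSet (I h U) b` as SETS and `𝒱 h U ∘ Φ h U = H_{J h U}`
POINTWISE.  A class member of the n08-b∕-c∕-d road is the Gaussian field `μ_K` of a kernel `K = A⁻¹` ZERO-EXTENDED off a finite `Λ ⊂ ℤ^d` (`…KernelOfPrecision`): its
coordinates off `Λ` vanish almost surely, while [2]'s small-field set `smallFieldSet I b = {z | ∀ x, |z x| ≤ b(1 + d(I, x))}` ([BenfattoEtAl1978] (A.1): a cut-off at EVERY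
tessera, thresholds growing with the distance from `I`) constrains them; and [B10]'s `χ_k` of (58) restricts the fluctuation field on its own variables only.  So for a
projection-type `Φ` the two sets differ by a `μ`-NULL set, and the natural hypotheses are the ALMOST-EVERYWHERE ones: `(Φ h U)⁻¹'(box h) =ᵐ[μ h U] smallFieldSet (I h U) b` and
`𝒱 h U ∘ Φ h U =ᵐ[μ h U] H`.  This part re-issues §3–§4 under them (the box integral by `setIntegral_congr_set` + `integral_congr_ae`, the free moment-cumulant letter by
`integral_congr_ae` on every moment), and adds the transport of the OTHER row that reads the letter — G3D-02 `hG`, whose target functional `U ↦ Σ_{n≤n̄} c k h U n ∕ n!` at the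
free letter IS the class road's `cumulantSum (μ h U) H n̄` under the presentation:
* §1 `integral_pow_map_eq_of_ae`, `cumulantOf_moments_map_eq_of_ae`, ★ `eq324_box_of_latticePresentation_ae` (one instance), `sum_freeLetter_eq_cumulantSum_of_ae`
  (`Σ_{n=1}^{n̄} cumulantOf(moments of V under μ𝔖) n ∕ n! = cumulantSum μ H n̄`).
* §2 `h324RowAt_freeLetter_of_latticePresentation_ae` (the (3.24) row, per `(h, U)`); ★ `graphRep23_freeLetter_of_latticePresentation_ae` (the G3D-02 row: a representation
  `GraphRep23AsCited (Gt h) (U ↦ cumulantSum (μ h U) (H h U) n̄) …` of the CLASS ROAD's cumulant sum IS the edition's `hG` at the free letter).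
* §3 ★★★ `exists_h324Row_freeLetter_of_classSandwich_ae` — part 1's plug with the a.e. presentation; `…_of_forall_gt_ae` (knit form `∀ b > b*`).
HONEST SCOPE.  As part 1: hypothesis-shape bookkeeping; the presentation, the sandwich, the graph representation and the class constants are HYPOTHESES (IDENT = class II ∕
NODE 00; N06 [B9] in-edges NOT claimed); nothing of [Balaban1985UV3] ∕ [BenfattoEtAl1978] asserted or discharged; `PrintedUV3V` NOT proved; N08 NOT discharged; count-neutral;
one finite 𝕋⁴ programme at fixed ε, Bałaban AS PRINTED — R4 closes the conditional finite-𝕋⁴ rung `BalabanLadder.UV` only; nothing continuum ∕ ℝ⁴ ∕ OS ∕ mass gap ∕ Clay.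

References: [Balaban1985UV3] T. Bałaban, CMP 102 (1985) 255–275 — (23) p. 262, (41) p. 266, (56)–(58) p. 270; [Balaban1982Higgs1] T. Bałaban, CMP 85 (1982) — (3.24) p. 616;
[BenfattoEtAl1978] G. Benfatto et al., CMP 59 (1978) — (2.7) p. 147, Lemma (4.6)–(4.7) p. 152, (A.1) p. 161.
-/

noncomputable section

namespace Summit.QuantumFields.YangMills.Theorems.BalabanUVNodesN08AlphaEq324RowClassSocketAE

open MeasureTheory
open scoped BigOperators Nat
open Literature.MathematicalPhysics.QuantumFieldTheory.Balaban1983to89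
open Literature.MathematicalPhysics.QuantumFieldTheory.Balaban1983to89.B1Sect3Statements (Eq324)
open Literature.MathematicalPhysics.QuantumFieldTheory.Balaban1983to89.B1Eq324BenfattoLemma
  (Coef hamiltonian coefSup smallFieldSet cutoffBoltzmann truncatedExp cumulantSum errTerm)
open Literature.MathematicalPhysics.QuantumFieldTheory.Balaban1985CMP102.Setting
open Literature.MathematicalPhysics.QuantumFieldTheory.Balaban1985CMP102.Binders (GraphTerms GraphRep23AsCited)
open Literature.MathematicalPhysics.QuantumFieldTheory.Balaban1983to89.TreeLengthTorus (tsys)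
open Summit.QuantumFields.Balaban3D.Carriers
open Summit.QuantumFields.Balaban3D.Proofs.Primitives (AlphaConsts)
open Summit.QuantumFields.Balaban3D.Proofs.GroupModelLieC (lieC)
open Summit.QuantumFields.YangMills.Theorems.BalabanUVNodesN08AlphaEq324RowCumLetterModel (setIntegral_exp_map_eq)
open Summit.QuantumFields.YangMills.Theorems.BalabanUVNodesN08AlphaEq324RowClassSocket
  (eq324Row_of_sandwich_gk_vol truncatedExp_eq_cumulantOf')
open Literature.Probability.LatticeModels (cumulantOf)

variable {L : ℕ}

/-! ## §1 One instance of the transport under an ALMOST-EVERYWHERE presentation -/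

section Instance

variable {d : ℕ} {Fl : Type*} [MeasurableSpace Fl]

/-- Moments under a push-forward with an a.e. identification of the pulled-back variable: `∫ Vᵐ d(μ∘Φ⁻¹) = ∫ Hᵐ dμ` when `V ∘ Φ = H` `μ`-a.e.
[folklore; cite: BenfattoEtAl1978, (2.7) p.147 (bookkeeping)] -/
theorem integral_pow_map_eq_of_ae (μ : Measure ((Fin d → ℤ) → ℝ)) {Φ : ((Fin d → ℤ) → ℝ) → Fl} (hΦ : Measurable Φ) {V : Fl → ℝ} (hVm : Measurable V)
    {H : ((Fin d → ℤ) → ℝ) → ℝ} (hV : (fun z => V (Φ z)) =ᵐ[μ] H) (m : ℕ) :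
    ∫ ω, V ω ^ m ∂(μ.map Φ) = ∫ z, H z ^ m ∂μ := by
  rw [integral_map hΦ.aemeasurable (hVm.pow_const m).aestronglyMeasurable]
  exact integral_congr_ae (hV.mono fun z hz => by simp only [← hz])

/-- … hence the free moment-cumulant letter of `V` under `μ∘Φ⁻¹` is [2]'s letter `ℰ_μᵀ(H; ·)`. [cite: BenfattoEtAl1978, (2.7) p.147 (bookkeeping)] -/
theorem cumulantOf_moments_map_eq_of_ae (μ : Measure ((Fin d → ℤ) → ℝ)) {Φ : ((Fin d → ℤ) → ℝ) → Fl} (hΦ : Measurable Φ) {V : Fl → ℝ} (hVm : Measurable V)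
    {H : ((Fin d → ℤ) → ℝ) → ℝ} (hV : (fun z => V (Φ z)) =ᵐ[μ] H) (n : ℕ) :
    cumulantOf (fun m => ∫ ω, V ω ^ m ∂(μ.map Φ)) n = truncatedExp μ H n := by
  rw [truncatedExp_eq_cumulantOf']
  congr 1
  funext m
  exact integral_pow_map_eq_of_ae μ hΦ hVm hV m

/-- ★ **ONE INSTANCE OF THE TRANSPORT, ALMOST-EVERYWHERE PRESENTATION.**  If a fluctuation block `(Fl, μ𝔖, box, V)` is presented by a lattice-field model `μ` —
`μ𝔖 = μ.map Φ`, `Φ` measurable, the box pulling back to a small-field set UP TO A `μ`-NULL SET `Φ⁻¹' box =ᵐ[μ] smallFieldSet I b`, the potential pulling back to a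
(4.5)-type Hamiltonian `μ`-ALMOST EVERYWHERE `V ∘ Φ =ᵐ[μ] H` — then `Eq324` for `(∫_{smallFieldSet I b} e^{H} dμ, ℰ_μᵀ(H; ·))` IS `Eq324` for
`(∫_{box} e^{V} dμ𝔖, free moment-cumulants of V under μ𝔖)`, same constants.  (Zero-extended class members: coordinates off `Λ` vanish a.s., [2]'s (A.1) cut-offs there hold a.s.)
[cite: Balaban1985UV3, (58) p.270; Balaban1982Higgs1, (3.24) p.616; BenfattoEtAl1978, (2.7) p.147 + (A.1) p.161 (bookkeeping)] -/
theorem eq324_box_of_latticePresentation_ae {μ𝔖 : Measure Fl} {box : Set Fl} {V : Fl → ℝ}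
    (μ : Measure ((Fin d → ℤ) → ℝ)) {Φ : ((Fin d → ℤ) → ℝ) → Fl} (hΦ : Measurable Φ) (hμ : μ𝔖 = μ.map Φ) (hboxm : MeasurableSet box) (hVm : Measurable V)
    {I : Finset (Fin d → ℤ)} {b : ℝ} (hbox : Φ ⁻¹' box =ᵐ[μ] smallFieldSet I b) {H : ((Fin d → ℤ) → ℝ) → ℝ} (hV : (fun z => V (Φ z)) =ᵐ[μ] H)
    {nbar : ℕ} {C₂ sc κ vol : ℝ} (h : Eq324 (∫ z in smallFieldSet I b, Real.exp (H z) ∂μ) (fun n => truncatedExp μ H n) nbar C₂ sc κ vol) :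
    Eq324 (∫ ω in box, Real.exp (V ω) ∂μ𝔖) (fun n => cumulantOf (fun m => ∫ ω, V ω ^ m ∂μ𝔖) n) nbar C₂ sc κ vol := by
  subst hμ
  have hint : ∫ ω in box, Real.exp (V ω) ∂(μ.map Φ) = ∫ z in smallFieldSet I b, Real.exp (H z) ∂μ := by
    rw [setIntegral_exp_map_eq μ hΦ hboxm hVm, setIntegral_congr_set hbox]
    exact integral_congr_ae (ae_restrict_of_ae (hV.mono fun z hz => by simp only [← hz]))
  have hc : (fun n => cumulantOf (fun m => ∫ ω, V ω ^ m ∂(μ.map Φ)) n) = fun n => truncatedExp μ H n :=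
    funext fun n => cumulantOf_moments_map_eq_of_ae μ hΦ hVm hV n
  rw [hint, hc]
  exact h

/-- **The G3D-02 functional at the free letter IS the class road's cumulant sum**: `Σ_{n=1}^{n̄} cumulantOf(moments of V under μ∘Φ⁻¹) n ∕ n! = cumulantSum μ H n̄` when
`V ∘ Φ =ᵐ[μ] H`. [cite: Balaban1985UV3, (23) p.262 + (58) p.270; BenfattoEtAl1978, (2.7) p.147 + (4.6) p.152 (bookkeeping)] -/
theorem sum_freeLetter_eq_cumulantSum_of_ae (μ : Measure ((Fin d → ℤ) → ℝ)) {Φ : ((Fin d → ℤ) → ℝ) → Fl} (hΦ : Measurable Φ) {V : Fl → ℝ}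
    (hVm : Measurable V) {H : ((Fin d → ℤ) → ℝ) → ℝ} (hV : (fun z => V (Φ z)) =ᵐ[μ] H) (nbar : ℕ) :
    ∑ n ∈ Finset.Icc 1 nbar, cumulantOf (fun m => ∫ ω, V ω ^ m ∂(μ.map Φ)) n / (n.factorial : ℝ) = cumulantSum μ H nbar := by
  simp only [cumulantSum, cumulantOf_moments_map_eq_of_ae μ hΦ hVm hV]

end Instance

/-! ## §2 The two letter-reading rows of the edited clauses, per `(h, U)`, under an a.e. presentation -/

section Rows

variable {d : ℕ} {S : Scales L} {G : Type} [GaugeGroup G] [MeasurableSpace G] [HaarData G] (𝔊 : GroupModel G) (𝔠 : AlphaConsts L 𝔊.N)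
  (𝔖 : ∀ k, StepSeries S G ↥(lieC 𝔊) (nblkOf S 𝔠.lane.carrier k) k) (k : ℕ)

/-- **THE RE-LETTERED (3.24) ROW AT `𝔖`'s FREE LETTER FROM AN A.E. LATTICE PRESENTATION, per `(h, U)`**: every presenting datum may depend on `(h, U)`; the box and
potential identifications hold `μ h U`-a.e. [cite: Balaban1985UV3, (58) p.270; Balaban1982Higgs1, (3.24) p.616] -/
theorem h324RowAt_freeLetter_of_latticePresentation_ae
    (μ : Hist S.P (k + 1) → GaugeField S.P (k + 1) G → Measure ((Fin d → ℤ) → ℝ))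
    (Φ : Hist S.P (k + 1) → GaugeField S.P (k + 1) G → ((Fin d → ℤ) → ℝ) → (𝔖 k).Fl) (hΦ : ∀ h U, Measurable (Φ h U))
    (hμ : ∀ h U, (𝔖 k).μ = (μ h U).map (Φ h U)) (hboxm : ∀ h, MeasurableSet ((𝔖 k).box h)) (hVm : ∀ h U, Measurable ((𝔖 k).𝒱 h U))
    (I : Hist S.P (k + 1) → GaugeField S.P (k + 1) G → Finset (Fin d → ℤ)) (b : Hist S.P (k + 1) → GaugeField S.P (k + 1) G → ℝ)
    (hbox : ∀ h U, Φ h U ⁻¹' (𝔖 k).box h =ᵐ[μ h U] smallFieldSet (I h U) (b h U))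
    (H : Hist S.P (k + 1) → GaugeField S.P (k + 1) G → ((Fin d → ℤ) → ℝ) → ℝ) (hV : ∀ h U, (fun z => (𝔖 k).𝒱 h U (Φ h U z)) =ᵐ[μ h U] H h U)
    {C₂ sc κ vol : ℝ}
    (h324' : ∀ h U, Eq324 (∫ z in smallFieldSet (I h U) (b h U), Real.exp (H h U z) ∂μ h U) (fun n => truncatedExp (μ h U) (H h U) n) 𝔠.nbar C₂ sc κ vol) :
    ∀ h (U : GaugeField S.P (k + 1) G), Eq324 (∫ ω in (𝔖 k).box h, Real.exp ((𝔖 k).𝒱 h U ω) ∂(𝔖 k).μ)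
      (fun n => cumulantOf (fun m => ∫ ω, (𝔖 k).𝒱 h U ω ^ m ∂(𝔖 k).μ) n) 𝔠.nbar C₂ sc κ vol :=
  fun h U => eq324_box_of_latticePresentation_ae (μ h U) (hΦ h U) (hμ h U) (hboxm h) (hVm h U) (hbox h U) (hV h U) (h324' h U)

/-- ★ **THE G3D-02 ROW AT THE FREE LETTER FROM AN A.E. LATTICE PRESENTATION**: if the graph carrier `Gt h` represents the CLASS ROAD's cumulant sum of the presenting member,
`GraphRep23AsCited ((𝔖 k).Gt h) (U ↦ cumulantSum (μ h U) (H h U) n̄) C₂₃ c₂₃ M₂₃ δ₀` ((23) for the Wick graphs of `μ h U`), then it represents the edition's target functional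
`U ↦ Σ_{n=1}^{n̄} c k h U n ∕ n!` at the free letter `c k h U n := cumulantOf (m ↦ ∫ (𝒱 h U)ᵐ d(𝔖 k).μ) n` — the field `StepAlphaEq324CoreLTAtAC.hG` ∕ `StepAlphaEq324CoreLTAt.hG`
there, character for character (the two functionals are EQUAL).  The representation itself is a HYPOTHESIS (NODE 00).
[cite: Balaban1985UV3, (23) p.262 + (58) p.270; BenfattoEtAl1978, (2.7) p.147] -/
theorem graphRep23_freeLetter_of_latticePresentation_ae
    (μ : Hist S.P (k + 1) → GaugeField S.P (k + 1) G → Measure ((Fin d → ℤ) → ℝ))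
    (Φ : Hist S.P (k + 1) → GaugeField S.P (k + 1) G → ((Fin d → ℤ) → ℝ) → (𝔖 k).Fl) (hΦ : ∀ h U, Measurable (Φ h U))
    (hμ : ∀ h U, (𝔖 k).μ = (μ h U).map (Φ h U)) (hVm : ∀ h U, Measurable ((𝔖 k).𝒱 h U))
    (H : Hist S.P (k + 1) → GaugeField S.P (k + 1) G → ((Fin d → ℤ) → ℝ) → ℝ) (hV : ∀ h U, (fun z => (𝔖 k).𝒱 h U (Φ h U z)) =ᵐ[μ h U] H h U)
    {C₂₃ c₂₃ M₂₃ δ₀ : ℝ} (hG' : ∀ h, GraphRep23AsCited ((𝔖 k).Gt h) (fun U => cumulantSum (μ h U) (H h U) 𝔠.nbar) C₂₃ c₂₃ M₂₃ δ₀) :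
    ∀ h, GraphRep23AsCited ((𝔖 k).Gt h)
      (fun U => ∑ n ∈ Finset.Icc 1 𝔠.nbar, cumulantOf (fun m => ∫ ω, (𝔖 k).𝒱 h U ω ^ m ∂(𝔖 k).μ) n / (n.factorial : ℝ)) C₂₃ c₂₃ M₂₃ δ₀ := by
  intro h
  have hfun : (fun U => ∑ n ∈ Finset.Icc 1 𝔠.nbar, cumulantOf (fun m => ∫ ω, (𝔖 k).𝒱 h U ω ^ m ∂(𝔖 k).μ) n / (n.factorial : ℝ)) =
      fun U => cumulantSum (μ h U) (H h U) 𝔠.nbar := by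
    funext U
    rw [hμ h U]
    exact sum_freeLetter_eq_cumulantSum_of_ae (μ h U) (hΦ h U) (hVm h U) (hV h U) 𝔠.nbar
  rw [hfun]
  exact hG' h

end Rows

/-! ## §3 THE PLUG under an a.e. presentation -/

section Plug

variable {G : Type} [GaugeGroup G] [MeasurableSpace G] [HaarData G] (𝔊 : GroupModel G) (𝔠 : AlphaConsts L 𝔊.N) {d : ℕ}

/-- ★★★ **THE (α)-ROW `h324` OF THE EDITED CLAUSES FROM THE CLASS ROAD's SANDWICH UNDER AN ALMOST-EVERYWHERE PRESENTATION, UNIFORMLY IN THE LATTICE APPROXIMATION.**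
Part 1's `exists_h324Row_freeLetter_of_classSandwich` with the presentation identities weakened to `(Φ h U)⁻¹'(box h) =ᵐ[μ h U] smallFieldSet (I h U) (p(g_k))` and
`𝒱 h U ∘ Φ h U =ᵐ[μ h U] H_{J h U}`: `∃ η₀ C` from the class constants and `(n̄, κ₀, σ)` alone; for every `S`, `𝔖`, `k` with `g_k ≤ η₀`, `v` with `C·v ≤ Ca + Cc`: `b* < p(g_k)`,
and the per-(h, U) sandwich at `b = p(g_k)`, `t = n̄` (in `eq324_of_sandwich_consts`'s literal currency) + smallness + volume give
`∀ h U, Eq324 (∫ ω in (𝔖 k).box h, e^{(𝔖 k).𝒱 h U ω} ∂(𝔖 k).μ) (n ↦ cumulantOf (m ↦ ∫ ((𝔖 k).𝒱 h U ω)^m ∂(𝔖 k).μ) n) 𝔠.nbar (𝔠.Ca + 𝔠.Cc) (Lᵏ·S.g0sq) (3 + 𝔠.κ₀) (S.sites k)`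
= `StepAlphaEq324CoreLTAtAC.h324` ∕ `StepAlphaEq324CoreLTAt.h324` at the free letter.
[cite: Balaban1985UV3, (41) p.266 + (56)–(58) p.270; Balaban1982Higgs1, (3.24) p.616; BenfattoEtAl1978, (2.7) p.147 + Lemma (4.6)–(4.7) p.152 + (A.1) p.161] -/
theorem exists_h324Row_freeLetter_of_classSandwich_ae {D : ℕ} {ϰ bstar Sc ρ₁ ρ₂ ρ₃ ρ₄ b₀ p₀ σ c₀ : ℝ}
    (hS : 0 ≤ Sc) (hρ₃ : 0 < ρ₃) (hb₀ : 0 < b₀) (hp₀ : 2 / 3 < p₀) (hσ : 0 < σ) (hc₀ : 0 ≤ c₀) (hκσ : 6 + 2 * 𝔠.κ₀ < σ * (𝔠.nbar + 1)) :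
    ∃ η₀ C : ℝ, 0 < η₀ ∧ η₀ ≤ 1 ∧ 0 ≤ C ∧
      ∀ (S : Scales L) (𝔖 : ∀ k, StepSeries S G ↥(lieC 𝔊) (nblkOf S 𝔠.lane.carrier k) k) (k : ℕ) (v : ℝ),
        S.gk k ≤ η₀ → C * v ≤ 𝔠.Ca + 𝔠.Cc →
        bstar < B10.pFun b₀ p₀ (S.gk k) ∧
        ∀ (μ : Hist S.P (k + 1) → GaugeField S.P (k + 1) G → Measure ((Fin d → ℤ) → ℝ))
          (Φ : Hist S.P (k + 1) → GaugeField S.P (k + 1) G → ((Fin d → ℤ) → ℝ) → (𝔖 k).Fl)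
          (s : ℕ) (I J : Hist S.P (k + 1) → GaugeField S.P (k + 1) G → Finset (Fin d → ℤ))
          (a : Hist S.P (k + 1) → GaugeField S.P (k + 1) G → Coef d),
          (∀ h U, Measurable (Φ h U)) → (∀ h U, (𝔖 k).μ = (μ h U).map (Φ h U)) →
          (∀ h, MeasurableSet ((𝔖 k).box h)) → (∀ h U, Measurable ((𝔖 k).𝒱 h U)) →
          (∀ h U, Φ h U ⁻¹' (𝔖 k).box h =ᵐ[μ h U] smallFieldSet (I h U) (B10.pFun b₀ p₀ (S.gk k))) →
          (∀ h U, (fun z => (𝔖 k).𝒱 h U (Φ h U z)) =ᵐ[μ h U] hamiltonian s D ϰ (a h U) (J h U)) →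
          (∀ h U, coefSup s D (a h U) (J h U) ≤ c₀ * S.gk k ^ σ) →
          (∀ h U, ((I h U).card : ℝ) ≤ v * S.sites k) →
          (∀ h U, Real.exp (cumulantSum (μ h U) (hamiltonian s D ϰ (a h U) (J h U)) 𝔠.nbar -
                ((I h U).card : ℝ) * errTerm Sc ρ₁ ρ₂ ρ₃ ρ₄ (coefSup s D (a h U) (J h U)) (B10.pFun b₀ p₀ (S.gk k)) 𝔠.nbar) ≤
              ∫ z, cutoffBoltzmann (hamiltonian s D ϰ (a h U) (J h U)) (I h U) (B10.pFun b₀ p₀ (S.gk k)) z ∂μ h U) →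
          (∀ h U, ∫ z, cutoffBoltzmann (hamiltonian s D ϰ (a h U) (J h U)) (I h U) (B10.pFun b₀ p₀ (S.gk k)) z ∂μ h U ≤
              Real.exp (cumulantSum (μ h U) (hamiltonian s D ϰ (a h U) (J h U)) 𝔠.nbar +
                ((I h U).card : ℝ) * errTerm Sc ρ₁ ρ₂ ρ₃ ρ₄ (coefSup s D (a h U) (J h U)) (B10.pFun b₀ p₀ (S.gk k)) 𝔠.nbar)) →
          ∀ h (U : GaugeField S.P (k + 1) G),
            Eq324 (∫ ω in (𝔖 k).box h, Real.exp ((𝔖 k).𝒱 h U ω) ∂(𝔖 k).μ)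
              (fun n => cumulantOf (fun m => ∫ ω, (𝔖 k).𝒱 h U ω ^ m ∂(𝔖 k).μ) n) 𝔠.nbar (𝔠.Ca + 𝔠.Cc)
              ((L : ℝ) ^ k * S.g0sq) (3 + 𝔠.κ₀) (S.sites k) := by
  obtain ⟨η₀, C, hη₀, hη₀1, hC, h⟩ :=
    eq324Row_of_sandwich_gk_vol 𝔠 (d := d) (D := D) (ϰ := ϰ) (bstar := bstar) (ρ₁ := ρ₁) (ρ₂ := ρ₂) (ρ₄ := ρ₄) hS hρ₃ hb₀ hp₀ hσ hc₀ hκσ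
  refine ⟨η₀, C, hη₀, hη₀1, hC, fun S 𝔖 k v hgk hCv => ?_⟩
  obtain ⟨hb, hE⟩ := h S k v hgk hCv
  refine ⟨hb, fun μ Φ s I J a hΦ hμ hboxm hVm hbox hV hA hI hlow hup => ?_⟩
  exact h324RowAt_freeLetter_of_latticePresentation_ae 𝔊 𝔠 𝔖 k μ Φ hΦ hμ hboxm hVm I (fun _ _ => B10.pFun b₀ p₀ (S.gk k)) hbox
    (fun h U => hamiltonian s D ϰ (a h U) (J h U)) hV
    (fun h U => hE (μ h U) s (I h U) (J h U) (a h U) (hA h U) (hI h U) (hlow h U) (hup h U))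

/-- **… WITH THE SANDWICH SUPPLIED IN KNIT FORM `∀ b > b*`** (applied at `b := p(g_k)`), a.e. presentation.
[cite: BenfattoEtAl1978, Lemma p.152 + b* p.159; Balaban1985UV3, (58) p.270; Balaban1982Higgs1, (3.24) p.616] -/
theorem exists_h324Row_freeLetter_of_classSandwich_of_forall_gt_ae {D : ℕ} {ϰ bstar Sc ρ₁ ρ₂ ρ₃ ρ₄ b₀ p₀ σ c₀ : ℝ}
    (hS : 0 ≤ Sc) (hρ₃ : 0 < ρ₃) (hb₀ : 0 < b₀) (hp₀ : 2 / 3 < p₀) (hσ : 0 < σ) (hc₀ : 0 ≤ c₀) (hκσ : 6 + 2 * 𝔠.κ₀ < σ * (𝔠.nbar + 1)) :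
    ∃ η₀ C : ℝ, 0 < η₀ ∧ η₀ ≤ 1 ∧ 0 ≤ C ∧
      ∀ (S : Scales L) (𝔖 : ∀ k, StepSeries S G ↥(lieC 𝔊) (nblkOf S 𝔠.lane.carrier k) k) (k : ℕ) (v : ℝ),
        S.gk k ≤ η₀ → C * v ≤ 𝔠.Ca + 𝔠.Cc →
        ∀ (μ : Hist S.P (k + 1) → GaugeField S.P (k + 1) G → Measure ((Fin d → ℤ) → ℝ))
          (Φ : Hist S.P (k + 1) → GaugeField S.P (k + 1) G → ((Fin d → ℤ) → ℝ) → (𝔖 k).Fl)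
          (s : ℕ) (I J : Hist S.P (k + 1) → GaugeField S.P (k + 1) G → Finset (Fin d → ℤ))
          (a : Hist S.P (k + 1) → GaugeField S.P (k + 1) G → Coef d),
          (∀ h U, Measurable (Φ h U)) → (∀ h U, (𝔖 k).μ = (μ h U).map (Φ h U)) →
          (∀ h, MeasurableSet ((𝔖 k).box h)) → (∀ h U, Measurable ((𝔖 k).𝒱 h U)) →
          (∀ h U, Φ h U ⁻¹' (𝔖 k).box h =ᵐ[μ h U] smallFieldSet (I h U) (B10.pFun b₀ p₀ (S.gk k))) →
          (∀ h U, (fun z => (𝔖 k).𝒱 h U (Φ h U z)) =ᵐ[μ h U] hamiltonian s D ϰ (a h U) (J h U)) →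
          (∀ h U, coefSup s D (a h U) (J h U) ≤ c₀ * S.gk k ^ σ) →
          (∀ h U, ((I h U).card : ℝ) ≤ v * S.sites k) →
          (∀ h U (b : ℝ), bstar < b →
            Real.exp (cumulantSum (μ h U) (hamiltonian s D ϰ (a h U) (J h U)) 𝔠.nbar -
                  ((I h U).card : ℝ) * errTerm Sc ρ₁ ρ₂ ρ₃ ρ₄ (coefSup s D (a h U) (J h U)) b 𝔠.nbar) ≤
                ∫ z, cutoffBoltzmann (hamiltonian s D ϰ (a h U) (J h U)) (I h U) b z ∂μ h U ∧
              ∫ z, cutoffBoltzmann (hamiltonian s D ϰ (a h U) (J h U)) (I h U) b z ∂μ h U ≤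
                Real.exp (cumulantSum (μ h U) (hamiltonian s D ϰ (a h U) (J h U)) 𝔠.nbar +
                  ((I h U).card : ℝ) * errTerm Sc ρ₁ ρ₂ ρ₃ ρ₄ (coefSup s D (a h U) (J h U)) b 𝔠.nbar)) →
          ∀ h (U : GaugeField S.P (k + 1) G),
            Eq324 (∫ ω in (𝔖 k).box h, Real.exp ((𝔖 k).𝒱 h U ω) ∂(𝔖 k).μ)
              (fun n => cumulantOf (fun m => ∫ ω, (𝔖 k).𝒱 h U ω ^ m ∂(𝔖 k).μ) n) 𝔠.nbar (𝔠.Ca + 𝔠.Cc)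
              ((L : ℝ) ^ k * S.g0sq) (3 + 𝔠.κ₀) (S.sites k) := by
  obtain ⟨η₀, C, hη₀, hη₀1, hC, h⟩ :=
    exists_h324Row_freeLetter_of_classSandwich_ae 𝔊 𝔠 (d := d) (D := D) (ϰ := ϰ) (bstar := bstar) (ρ₁ := ρ₁) (ρ₂ := ρ₂) (ρ₄ := ρ₄)
      hS hρ₃ hb₀ hp₀ hσ hc₀ hκσ
  refine ⟨η₀, C, hη₀, hη₀1, hC, fun S 𝔖 k v hgk hCv μ Φ s I J a hΦ hμ hboxm hVm hbox hV hA hI hknit => ?_⟩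
  obtain ⟨hb, hE⟩ := h S 𝔖 k v hgk hCv
  exact hE μ Φ s I J a hΦ hμ hboxm hVm hbox hV hA hI (fun h' U => (hknit h' U _ hb).1) (fun h' U => (hknit h' U _ hb).2)

end Plug

end Summit.QuantumFields.YangMills.Theorems.BalabanUVNodesN08AlphaEq324RowClassSocketAE

end
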